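import Literature.Analysis.FluidPDE.SelfSimilarEulerProfile
import Literature.Analysis.FluidPDE.HomogeneousEulerProofs
import HarnessLib

/-!
# Self-similar Euler profiles which are homogeneous near infinity are governed, in their tail, by
# Shvydkoy's homogeneous STATIONARY Euler system

Chae–Shvydkoy, *On formation of a locally self-similar collapse in the incompressible Euler
equations*, ARMA 209 (2013) = arXiv:1201.6009 [`ChaeShvydkoy2013`], §4.1 (p. 10 of the held
text) call a profile `v ∈ C¹_loc(ℝᴺ)` **homogeneous near infinity** if
`v(y) = V(y/|y|)/|y|^β` for all `|y|` large, and exclude such profiles (Thm 4.2) in the cases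
`0 < β < α`, `-1 < α < β`, `α = β = N/2` — i.e. precisely NOT in the scaling-invariant case
`β = α` («homogeneous near infinity solutions are eliminated as well except when homogeneity is
scaling invariant», p. 2).  Shvydkoy, *Homogeneous solutions to the 3D Euler system*, Trans. AMS
370 (2018) = arXiv:1510.03378 [`Shvydkoy2018`], §1 (p. 3 of the held text): «under a mild growth
restriction on the profile V, V necessarily behaves like 1/|x|^α at infinity [BrShv, ChShv]. This
suggests that homogeneous solutions are the only ones that exist in the class of self-similar» —
and studies the STATIONARY homogeneous system `V·∇V + ∇P = 0`, `div V = 0` on `ℝ³ ∖ {0}`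
(tree: `IsHomogeneousSteadyEuler`).

This file proves the elementary bridge between the two (folklore; the computation behind both
quotations): in the self-similar profile equation (Constantin–Ignatova–Vicol (3.3), tree
`IsSelfSimilarEulerProfile γ 0 U P`)

  `(1 − γ) U + γ (y·∇)U + (U·∇)U + ∇P = 0`, `div U = 0`,

the LINEAR part `(1−γ)U + γ(y·∇)U` vanishes identically on any field homogeneous of the
scaling-consistent degree `−α`, `γ α = 1 − γ` (Euler's relation `(y·∇)W = −αW`), so that if
`(U, P)` agrees outside a ball with a globally homogeneous pair `(W, Q)` of degrees `(−α, −2α)`,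
then `(W, Q)` solves the STATIONARY Euler system off the origin (first on the exterior of the
ball, then everywhere by dilation covariance): `IsHomogeneousSteadyEuler α W Q`.

* `IsSelfSimilarEulerProfile.isHomogeneousSteadyEuler_of_homogeneous_tail` — the bridge.
* `IsSelfSimilarEulerProfile.tail_eq_zero_of_homogeneous_tail_half` — corollary at the
  circulation-preserving exponent `γ = 1/2` (`α = 1`, the Landau / Navier–Stokes scaling), in
  `ℝ³`: by Shvydkoy 2018 Prop. 2.1 (PROVED in the tree,
  `shvydkoy_homogeneousSteadyEuler_alpha_one_holds`) such a profile VANISHES outside the ball.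
  This case (`α = β = 1`, `N = 3`) is not among those of Chae–Shvydkoy Thm 4.2.

Scope / honesty: homogeneity of the pressure tail is ASSUMED (it follows from that of the
velocity up to an additive constant — `∇q = −v·∇v` is homogeneous of degree `−2β−1` on the
connected exterior — which is not derived here: `-- TODO(general form)`).  For the Chae–Shvydkoy
window `α ∈ (1, 3/2]` (crux `EulerZoomLiouville.PowerGaugeEulerLiouville`, `α = 1 + ρ`,
`γ = 1/(2+ρ)`) no unconditional exclusion of `C¹` homogeneous stationary solutions is in print
(Shvydkoy 2018 p. 4 CONJECTURES none exist for `α > −1` except the irrotational ones at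
`α ∈ ℤ ∖ {1}`; proved there: `α = 1` (Prop. 2.1), axisymmetric `0 < α < 2` (Prop. 5.1),
spherical pressure `p ≥ 0` (Cor. 4.4), irrotational ⇒ `α ∈ ℤ` (Prop. 3.1)).

## References
* D. Chae, R. Shvydkoy, ARMA 209 (2013) 999–1017 = arXiv:1201.6009, §4.1, Thm 4.2.
* R. Shvydkoy, Trans. AMS 370 (2018) 2517–2535 = arXiv:1510.03378, §1, Prop. 2.1.
* P. Constantin, M. Ignatova, V. Vicol, arXiv:2602.17570 (2026), (3.3).
-/

noncomputable section

open Set Filter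
open scoped InnerProductSpace RealInnerProductSpace Topology

namespace Literature.Analysis.FluidPDE

namespace IsSelfSimilarEulerProfile

variable {E : Type*} [NormedAddCommGroup E] [InnerProductSpace ℝ E] [FiniteDimensional ℝ E]
variable {γ α R : ℝ} {U W : E → E} {P Q : E → ℝ}

omit [FiniteDimensional ℝ E] in
/-- Every ray from the origin leaves any ball: for `x ≠ 0` there is `c > 0` with `R < ‖c • x‖`.
[folklore] -/
private theorem exists_pos_smul_norm_gt (R : ℝ) {x : E} (hx : x ≠ 0) :
    ∃ c : ℝ, 0 < c ∧ R < ‖c • x‖ := by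
  have hxn : 0 < ‖x‖ := norm_pos_iff.mpr hx
  refine ⟨(|R| + 1) / ‖x‖, div_pos (by positivity) hxn, ?_⟩
  rw [norm_smul, Real.norm_eq_abs, abs_of_pos (div_pos (by positivity) hxn),
    div_mul_cancel₀ _ hxn.ne']
  exact lt_of_le_of_lt (le_abs_self R) (lt_add_one _)

omit [FiniteDimensional ℝ E] in
/-- Local representation of a homogeneous velocity tail through the profile: if `W(c z) = c^{-α} W(z)`
(`c > 0`, `z ≠ 0`), `U = W` on `{R < ‖y‖}`, `x ≠ 0` and `R < ‖c • x‖`, then near `x`,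
`W(z) = c^{α} U(c z)`. [folklore] -/
private theorem tail_velocity_eventuallyEq
    (hW : ∀ ⦃c : ℝ⦄, 0 < c → ∀ ⦃x : E⦄, x ≠ 0 → W (c • x) = c ^ (-α) • W x)
    (hUW : ∀ ⦃y : E⦄, R < ‖y‖ → U y = W y) {x : E} (hx : x ≠ 0) {c : ℝ} (hc : 0 < c)
    (hcx : R < ‖c • x‖) :
    W =ᶠ[𝓝 x] fun z => c ^ α • U (c • z) := by
  have hopen : IsOpen ({z : E | z ≠ 0} ∩ (fun z : E => c • z) ⁻¹' {y : E | R < ‖y‖}) :=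
    isOpen_ne.inter ((isOpen_lt continuous_const continuous_norm).preimage (continuous_const_smul c))
  have hmem : x ∈ {z : E | z ≠ 0} ∩ (fun z : E => c • z) ⁻¹' {y : E | R < ‖y‖} := ⟨hx, hcx⟩
  filter_upwards [hopen.mem_nhds hmem] with z hz
  obtain ⟨hz0, hzR⟩ := hz
  have h1 : W (c • z) = c ^ (-α) • W z := hW hc hz0
  have h2 : U (c • z) = W (c • z) := hUW hzR
  rw [h2, h1, smul_smul, ← Real.rpow_add hc, add_neg_cancel, Real.rpow_zero, one_smul]

omit [FiniteDimensional ℝ E] in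
/-- Local representation of a homogeneous pressure tail through the profile pressure: near `x ≠ 0`
with `R < ‖c • x‖`, `Q(z) = c^{2α} P(c z)`. [folklore] -/
private theorem tail_pressure_eventuallyEq
    (hQ : ∀ ⦃c : ℝ⦄, 0 < c → ∀ ⦃x : E⦄, x ≠ 0 → Q (c • x) = c ^ (-(2 * α)) * Q x)
    (hPQ : ∀ ⦃y : E⦄, R < ‖y‖ → P y = Q y) {x : E} (hx : x ≠ 0) {c : ℝ} (hc : 0 < c)
    (hcx : R < ‖c • x‖) :
    Q =ᶠ[𝓝 x] fun z => c ^ (2 * α) * P (c • z) := by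
  have hopen : IsOpen ({z : E | z ≠ 0} ∩ (fun z : E => c • z) ⁻¹' {y : E | R < ‖y‖}) :=
    isOpen_ne.inter ((isOpen_lt continuous_const continuous_norm).preimage (continuous_const_smul c))
  have hmem : x ∈ {z : E | z ≠ 0} ∩ (fun z : E => c • z) ⁻¹' {y : E | R < ‖y‖} := ⟨hx, hcx⟩
  filter_upwards [hopen.mem_nhds hmem] with z hz
  obtain ⟨hz0, hzR⟩ := hz
  have h1 : Q (c • z) = c ^ (-(2 * α)) * Q z := hQ hc hz0
  have h2 : P (c • z) = Q (c • z) := hPQ hzR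
  rw [h2, h1, ← mul_assoc, ← Real.rpow_add hc, add_neg_cancel, Real.rpow_zero, one_mul]

/-- Derivative of the velocity tail at `x ≠ 0` through the profile derivative at `y = c • x` in the
exterior: `DW(x) v = c^{α+1} DU(c x) v`. [folklore] -/
private theorem hasFDerivAt_tail_velocity (h : IsSelfSimilarEulerProfile γ 0 U P)
    (hW : ∀ ⦃c : ℝ⦄, 0 < c → ∀ ⦃x : E⦄, x ≠ 0 → W (c • x) = c ^ (-α) • W x)
    (hUW : ∀ ⦃y : E⦄, R < ‖y‖ → U y = W y) {x : E} (hx : x ≠ 0) {c : ℝ} (hc : 0 < c)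
    (hcx : R < ‖c • x‖) :
    HasFDerivAt W (c ^ (α + 1) • fderiv ℝ U (c • x)) x := by
  have hlin : HasFDerivAt (fun z : E => c • z) (c • ContinuousLinearMap.id ℝ E) x :=
    (hasFDerivAt_id x).const_smul c
  have hU : HasFDerivAt U (fderiv ℝ U (c • x)) (c • x) := (h.differentiable_velocity _).hasFDerivAt
  have hcomp : HasFDerivAt (fun z : E => c ^ α • U (c • z))
      (c ^ α • ((fderiv ℝ U (c • x)).comp (c • ContinuousLinearMap.id ℝ E))) x :=
    (hU.comp x hlin).const_smul (c ^ α)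
  have heq : c ^ α • ((fderiv ℝ U (c • x)).comp (c • ContinuousLinearMap.id ℝ E)) =
      c ^ (α + 1) • fderiv ℝ U (c • x) := by
    ext v
    simp only [FunLike.coe_smul, Pi.smul_apply, ContinuousLinearMap.comp_apply,
      ContinuousLinearMap.id_apply, map_smul, smul_smul]
    rw [Real.rpow_add hc, Real.rpow_one]
  rw [← heq]
  exact hcomp.congr_of_eventuallyEq (tail_velocity_eventuallyEq hW hUW hx hc hcx)

/-- Derivative of the pressure tail at `x ≠ 0` through the profile pressure derivative at `c • x`:
`DQ(x) = c^{2α+1} DP(c x)`. [folklore] -/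
private theorem hasFDerivAt_tail_pressure (h : IsSelfSimilarEulerProfile γ 0 U P)
    (hQ : ∀ ⦃c : ℝ⦄, 0 < c → ∀ ⦃x : E⦄, x ≠ 0 → Q (c • x) = c ^ (-(2 * α)) * Q x)
    (hPQ : ∀ ⦃y : E⦄, R < ‖y‖ → P y = Q y) {x : E} (hx : x ≠ 0) {c : ℝ} (hc : 0 < c)
    (hcx : R < ‖c • x‖) :
    HasFDerivAt Q (c ^ (2 * α + 1) • fderiv ℝ P (c • x)) x := by
  have hlin : HasFDerivAt (fun z : E => c • z) (c • ContinuousLinearMap.id ℝ E) x :=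
    (hasFDerivAt_id x).const_smul c
  have hP : HasFDerivAt P (fderiv ℝ P (c • x)) (c • x) := (h.differentiable_pressure _).hasFDerivAt
  have hcomp : HasFDerivAt (fun z : E => c ^ (2 * α) * P (c • z))
      (c ^ (2 * α) • ((fderiv ℝ P (c • x)).comp (c • ContinuousLinearMap.id ℝ E))) x :=
    (hP.comp x hlin).const_mul (c ^ (2 * α))
  have heq : c ^ (2 * α) • ((fderiv ℝ P (c • x)).comp (c • ContinuousLinearMap.id ℝ E)) =
      c ^ (2 * α + 1) • fderiv ℝ P (c • x) := by
    ext v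
    simp only [FunLike.coe_smul, Pi.smul_apply, ContinuousLinearMap.comp_apply,
      ContinuousLinearMap.id_apply, map_smul, smul_eq_mul, ← mul_assoc]
    rw [Real.rpow_add hc, Real.rpow_one]
  rw [← heq]
  exact hcomp.congr_of_eventuallyEq (tail_pressure_eventuallyEq hQ hPQ hx hc hcx)

/-- **In the exterior region the stationary Euler equation holds**: at a point `y` with `R < ‖y‖`
and `y ≠ 0`, the linear part of the profile equation vanishes on the homogeneous tail
(`γ DU(y) y = −γα U(y) = −(1−γ) U(y)`), leaving `(U·∇)U + ∇P = 0`. [cite: ChaeShvydkoy2013, §4.1] -/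
theorem convect_add_gradient_eq_zero_of_exterior (h : IsSelfSimilarEulerProfile γ 0 U P)
    (hαγ : γ * α = 1 - γ)
    (hW : ∀ ⦃c : ℝ⦄, 0 < c → ∀ ⦃x : E⦄, x ≠ 0 → W (c • x) = c ^ (-α) • W x)
    (hUW : ∀ ⦃y : E⦄, R < ‖y‖ → U y = W y) {y : E} (hy : y ≠ 0) (hyR : R < ‖y‖) :
    convect U U y + gradient P y = 0 := by
  -- `W = U` near `y` (take `c = 1`), so the Euler relation of `W` is one of `U`
  have hev : W =ᶠ[𝓝 y] fun z => (1 : ℝ) ^ α • U ((1 : ℝ) • z) :=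
    tail_velocity_eventuallyEq hW hUW hy one_pos (by simpa using hyR)
  have hev' : W =ᶠ[𝓝 y] U := hev.trans (Eventually.of_forall fun z => by simp)
  have hdW : DifferentiableAt ℝ W y :=
    (h.differentiable_velocity y).congr_of_eventuallyEq hev'
  have heuler : fderiv ℝ W y y = (-α) • W y :=
    fderiv_apply_self_of_smul_eq_rpow_smul (fun _ hc => hW hc hy) hdW
  have hfd : fderiv ℝ W y = fderiv ℝ U y := hev'.fderiv_eq
  have hWy : W y = U y := (hUW hyR).symm
  rw [hfd, hWy] at heuler
  -- the profile equation at `y`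
  have hpe := h.profile_eq' y
  rw [sub_zero, heuler, smul_smul] at hpe
  -- `(1 - γ) • U y + (γ * -α) • U y = 0`
  have hlin : (1 - γ) • U y + (γ * -α) • U y = 0 := by
    rw [← add_smul]
    have : 1 - γ + γ * -α = 0 := by linarith [hαγ]
    rw [this, zero_smul]
  have := hpe
  rw [show (1 - γ) • U y + (γ * -α) • U y + convect U U y + gradient P y =
      ((1 - γ) • U y + (γ * -α) • U y) + (convect U U y + gradient P y) by abel, hlin,
    zero_add] at this
  exact this

/-- **The bridge** (Chae–Shvydkoy 2013 §4.1 ⟷ Shvydkoy 2018 (1)–(2)).  Let `(U, P)` be a `C²/C¹`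
self-similar Euler profile centred at `0` with exponent `γ` (`IsSelfSimilarEulerProfile γ 0 U P`),
let `α` be the scaling-consistent degree, `γ α = 1 − γ`, and let `(W, Q)` be globally homogeneous
of degrees `−α`, `−2α` under dilations and agree with `(U, P)` outside the ball of radius `R`.
Then `(W, Q)` is a `C¹` homogeneous STATIONARY Euler pair on `E ∖ {0}` in the sense of Shvydkoy:
`IsHomogeneousSteadyEuler α W Q`. [cite: ChaeShvydkoy2013, §4.1; cf. Shvydkoy2018, §1 p. 3] -/
theorem isHomogeneousSteadyEuler_of_homogeneous_tail (h : IsSelfSimilarEulerProfile γ 0 U P)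
    (hαγ : γ * α = 1 - γ)
    (hW : ∀ ⦃c : ℝ⦄, 0 < c → ∀ ⦃x : E⦄, x ≠ 0 → W (c • x) = c ^ (-α) • W x)
    (hQ : ∀ ⦃c : ℝ⦄, 0 < c → ∀ ⦃x : E⦄, x ≠ 0 → Q (c • x) = c ^ (-(2 * α)) * Q x)
    (hUW : ∀ ⦃y : E⦄, R < ‖y‖ → U y = W y) (hPQ : ∀ ⦃y : E⦄, R < ‖y‖ → P y = Q y) :
    IsHomogeneousSteadyEuler α W Q where
  contDiffOn_velocity := by
    intro x hx
    obtain ⟨c, hc, hcx⟩ := exists_pos_smul_norm_gt R (x := x) hx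
    have hsm : ContDiffAt ℝ 1 (fun z : E => c ^ α • U (c • z)) x := by
      have hU : ContDiffAt ℝ 1 U (c • x) :=
        (h.contDiff_velocity.of_le (by norm_num)).contDiffAt
      exact (hU.comp x (contDiffAt_id.const_smul c)).const_smul (c ^ α)
    exact (hsm.congr_of_eventuallyEq (tail_velocity_eventuallyEq hW hUW hx hc hcx)).contDiffWithinAt
  contDiffOn_pressure := by
    intro x hx
    obtain ⟨c, hc, hcx⟩ := exists_pos_smul_norm_gt R (x := x) hx
    have hsm : ContDiffAt ℝ 1 (fun z : E => c ^ (2 * α) * P (c • z)) x := by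
      have hP : ContDiffAt ℝ 1 P (c • x) := h.contDiff_pressure.contDiffAt
      exact contDiffAt_const.mul (hP.comp x (contDiffAt_id.const_smul c))
    exact (hsm.congr_of_eventuallyEq (tail_pressure_eventuallyEq hQ hPQ hx hc hcx)).contDiffWithinAt
  velocity_smul := hW
  pressure_smul := hQ
  divergence_eq_zero := by
    intro x hx
    obtain ⟨c, hc, hcx⟩ := exists_pos_smul_norm_gt R (x := x) hx
    have hfd := (hasFDerivAt_tail_velocity h hW hUW hx hc hcx).fderiv
    have hdivU : VectorCalculus.divergence U (c • x) = 0 := h.divFree (c • x)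
    unfold VectorCalculus.divergence at hdivU ⊢
    rw [hfd, ContinuousLinearMap.toLinearMap_smul, map_smul, hdivU, smul_zero]
  momentum := by
    intro x hx
    obtain ⟨c, hc, hcx⟩ := exists_pos_smul_norm_gt R (x := x) hx
    have hcx0 : c • x ≠ 0 := smul_ne_zero hc.ne' hx
    have hext := convect_add_gradient_eq_zero_of_exterior h hαγ hW hUW hcx0 hcx
    have hfdW := (hasFDerivAt_tail_velocity h hW hUW hx hc hcx).fderiv
    have hfdQ := (hasFDerivAt_tail_pressure h hQ hPQ hx hc hcx).fderiv
    -- the value of the tail at `x` through the profile at `c • x`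
    have hWx : W x = c ^ α • U (c • x) :=
      (tail_velocity_eventuallyEq hW hUW hx hc hcx).self_of_nhds
    -- the gradient of `Q` at `x`
    have hgradQ : gradient Q x = c ^ (2 * α + 1) • gradient P (c • x) := by
      rw [gradient, gradient, hfdQ, map_smul]
    -- the convective term of `W` at `x`
    have hconv : convect W W x = c ^ (2 * α + 1) • convect U U (c • x) := by
      rw [convect_apply, convect_apply, hfdW, hWx, FunLike.coe_smul, Pi.smul_apply, map_smul, smul_smul,
        ← Real.rpow_add hc]
      congr 1
      ring_nf
    rw [hconv, hgradQ, ← smul_add, hext, smul_zero]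

/-- **Corollary at the circulation-preserving exponent `γ = 1/2` (`α = 1`) in `ℝ³`**: a `C²/C¹`
self-similar Euler profile whose velocity and pressure agree outside a ball with a globally
homogeneous pair of the Landau / Navier–Stokes degrees `(−1, −2)` VANISHES outside that ball —
by the bridge and Shvydkoy 2018 Prop. 2.1 (`shvydkoy_homogeneousSteadyEuler_alpha_one_holds`,
proved in the tree).  Not among the cases of Chae–Shvydkoy 2013 Thm 4.2 (`α = β = 1 ≠ N/2`).
[cite: Shvydkoy2018, Prop. 2.1; ChaeShvydkoy2013, §4.1] -/
theorem tail_eq_zero_of_homogeneous_tail_half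
    {U W : EuclideanSpace ℝ (Fin 3) → EuclideanSpace ℝ (Fin 3)} {P Q : EuclideanSpace ℝ (Fin 3) → ℝ}
    {R : ℝ} (h : IsSelfSimilarEulerProfile (1 / 2 : ℝ) 0 U P)
    (hW : ∀ ⦃c : ℝ⦄, 0 < c → ∀ ⦃x : EuclideanSpace ℝ (Fin 3)⦄, x ≠ 0 → W (c • x) = c ^ (-(1 : ℝ)) • W x)
    (hQ : ∀ ⦃c : ℝ⦄, 0 < c → ∀ ⦃x : EuclideanSpace ℝ (Fin 3)⦄, x ≠ 0 →
      Q (c • x) = c ^ (-(2 * (1 : ℝ))) * Q x)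
    (hUW : ∀ ⦃y : EuclideanSpace ℝ (Fin 3)⦄, R < ‖y‖ → U y = W y)
    (hPQ : ∀ ⦃y : EuclideanSpace ℝ (Fin 3)⦄, R < ‖y‖ → P y = Q y)
    ⦃y : EuclideanSpace ℝ (Fin 3)⦄ (hy : y ≠ 0) (hyR : R < ‖y‖) : U y = 0 ∧ P y = 0 := by
  have hVP : IsHomogeneousSteadyEuler 1 W Q :=
    isHomogeneousSteadyEuler_of_homogeneous_tail h (by norm_num) hW hQ hUW hPQ
  have hW0 : W y = 0 := shvydkoy_homogeneousSteadyEuler_alpha_one_holds hVP hy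
  have hQ0 : Q y = 0 :=
    shvydkoy_homogeneousSteadyEuler_alpha_one.pressure_eq_zero
      shvydkoy_homogeneousSteadyEuler_alpha_one_holds hVP hy
  exact ⟨(hUW hyR).trans hW0, (hPQ hyR).trans hQ0⟩

end IsSelfSimilarEulerProfile

end Literature.Analysis.FluidPDE

end
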